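import Summits.ResolutionOfSingularities.ResolutionOfSingularities.Theorems.EquisingularLiftEquisingularLiftNatNDRoundModel
import Summits.ResolutionOfSingularities.ResolutionOfSingularities.Theorems.EquisingularLiftEquisingularLiftNatNDChartPlays
import Literature.AlgebraicGeometry.Resolution.PointBlowupHsFunMono
import Literature.AlgebraicGeometry.Resolution.StalkIdealLemmas
import Literature.AlgebraicGeometry.Resolution.NormalCrossingsLocal
import Literature.AlgebraicGeometry.Resolution.RegularLocalRingsQuotient
import Literature.AlgebraicGeometry.Resolution.ProjectiveSpaceRegular
import Mathlib.RingTheory.RegularLocalRing.Polynomial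
import Mathlib.RingTheory.Nullstellensatz
import HarnessLib

/-!
# [OURS · L1 W4.5(b) · EL♮(3)] (B4α2) END OF THE MODEL ROUND, chart level — `…NatNDModelRoundEndChart`: the `ToricStage`-free core `modelEnd_of_charts`
# of the brick `modelEnd : LocalND g → ModelEnd n k g` (idea-1 ROUND 12 / SPEC v9–v10 §13.14 (B4α2); desk WIDTH TABLE D1 2026-08-28T14:38:46Z row iso-w1)

OURS · L1 W4.5(b) · EL♮(3) stmt-ResolutionOfSingularities-20148 (parent EL♮ stmt-…-20038) · counted 0 · AI-written (res-L1-w45b-iso-w1 g0, WIDTH seat on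
D-0157 DOOR 1), weaker than expert review; nothing of [Hironaka2017] asserted; no statement of the manuscript; dim-3 char-p resolution is CP 2008/2009 in
print — this is a piece of OUR kernel-own version.  Sorry-free, def-free, standard axioms, no instance, no notation.
`--supports stmt-ResolutionOfSingularities-20148 --as helper`: support toward the registered 4th CHILD stub `stub_elnat_three_isolated_newtonNondegenerate`
(`IsoHypNDWon → ELNatConclusionO`) through the k-side brick chain (B4α2) `modelEnd` → `modelRound` → `roundAtNDFrame` → `ndInv_round` → `nd_rung_local`.

WHAT IS PROVED (all `n`, every field `k`, `k = k̄` where stated):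
* §A `mul_notMem_sq_of_derivation_notMem`, `algebraMap_notMem_sq_maximalIdeal_of_derivation` — a derivation `D` with `D f ∉ 𝔭 ∋ f` certifies `f ∉ 𝔭⁽²⁾`
  (Leibniz), i.e. `f ∉ 𝔪²` in `A_𝔭`.
* §B `stalkIdeal_vanishingIdeal_zeroLocus_singleton` — on `Spec A` the stalk of the vanishing ideal sheaf of the closed SET `V(G)` is `√(G)_y`;
  `isRegularLocalRing_stalk_quotient_vanishingIdeal_zeroLocus` — for `A` regular, `G ∈ 𝔭_y`, `D G ∉ 𝔭_y`: `𝒪_{Spec A,y} ⧸ 𝓘(V(G))_y` is a regular local ring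
  (`𝒪_y/(G)` regular by Matsumura 14.2, hence a domain, so `(G)_y` is prime `= √(G)_y`).  The easy half of the Jacobian criterion, at NON-closed points too.
* §C toric charts `c : 𝔸ⁿ_k ⟶ F` with `c ≫ φ = Spec (t_l ↦ ∏ᵢ yᵢ^{B i l})` and `c⁻¹ T = V(toricStrict B g)`: `exists_pos_mem_of_comap_eq_affOrigin` (over the origin ⇒
  every column has a vanishing coordinate of positive weight), `exists_forall_eval_eq_zero` (weak Nullstellensatz, Mathlib), `exists_pderiv_toricStrict_notMem`
  (at a WON position some `∂ⱼ (toricStrict B g) ∉ 𝔭` for every prime `𝔭 ∋ toricStrict B g` over the origin — `exists_eval_pderiv_toricStrict_ne_zero` of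
  `…NatNDChartEnd` at a closed point of `V(𝔭)`, which is still over the origin; USES `k = k̄`, cf. crit-3's witness 2026-08-28T14:21:05Z),
  `isRegular_of_forall_exists_affChart`, `isRegularLocalRing_stalk_vanishingIdeal_of_chart` (transport along the stalk isomorphism of `c`).
* §D `modelEnd_of_charts` — `Scheme.IsRegular F` and the END clause of `ModelRound`/`ModelEnd` VERBATIM (`T̂ := 𝓘(closure T).subscheme` regular at every point
  over `affOrigin`) from the (TS1) chart data of a toric stage, `IsClosed T` and `Won (table g) Φ`.  The by-name brick `modelEnd (n) (k) [Field k] [IsAlgClosed k]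
  (g) (hg : LocalND g) : ModelEnd n k g` is the 6-line wrapper `obtain ⟨…, hcharts, …, hT, …⟩ := hst; exact modelEnd_of_charts …` filed the minute the text
  owner's port `…NatNDRoundModelSplit` (`ToricStage`, `ModelEnd`) is a tree module (scratch green against idea-1's port draft v2 4f7cfcb931f4dd23).
-/

set_option linter.dupNamespace false

noncomputable section

open CategoryTheory CategoryTheory.Limits AlgebraicGeometry TopologicalSpace Topology
open MvPolynomial IsLocalRing
open Literature.AlgebraicGeometry.Resolution
open AlgebraicGeometry.Scheme.IdealSheafData

namespace Summit.ResolutionOfSingularities.ResolutionOfSingularities.Cruxes.EquisingularLiftNat.Sections.ND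

open Summit.ResolutionOfSingularities.ResolutionOfSingularities.Cruxes.EquisingularLiftNat.Sections

/-! ### A. Derivations detect order one at a prime -/

/-- If `f ∈ Q` and `D f ∉ Q` for a derivation `D` and a prime ideal `Q`, then `u * f ∉ Q²` for every `u ∉ Q` (Leibniz: `D(Q²) ⊆ Q`).
[OURS · folklore, cf. Stacks 07PF] -/
theorem mul_notMem_sq_of_derivation_notMem {A : Type*} [CommRing A] {S₀ : Type*} [CommSemiring S₀] [Algebra S₀ A]
    (D : Derivation S₀ A A) {Q : Ideal A} [Q.IsPrime] {f : A} (hfQ : f ∈ Q) (hDf : D f ∉ Q) {u : A} (hu : u ∉ Q) :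
    u * f ∉ Q ^ 2 := by
  intro huf
  have key : ∀ x ∈ Q ^ 2, D x ∈ Q := by
    intro x hx
    rw [pow_two] at hx
    refine Submodule.mul_induction_on hx (fun a ha b hb => ?_) (fun a b ha hb => ?_)
    · rw [Derivation.leibniz, smul_eq_mul, smul_eq_mul]
      exact Q.add_mem (Q.mul_mem_right _ ha) (Q.mul_mem_right _ hb)
    · rw [map_add]
      exact Q.add_mem ha hb
  have h1 : D (u * f) ∈ Q := key _ huf
  rw [Derivation.leibniz, smul_eq_mul, smul_eq_mul] at h1
  have h2 : u * D f ∈ Q := (Ideal.add_mem_iff_left Q (Q.mul_mem_right _ hfQ)).mp h1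
  exact hDf ((Ideal.IsPrime.mem_or_mem ‹_› h2).resolve_left hu)

/-- In a localisation `S` of `A` at the prime `Q`: if `f ∈ Q` and `D f ∉ Q` for some derivation `D` of `A`, then the image of `f` is NOT in `𝔪_S²`.
[OURS · folklore] -/
theorem algebraMap_notMem_sq_maximalIdeal_of_derivation {A S : Type*} [CommRing A] [CommRing S] [Algebra A S] (Q : Ideal A) [Q.IsPrime]
    [IsLocalRing S] [IsLocalization.AtPrime S Q] {S₀ : Type*} [CommSemiring S₀] [Algebra S₀ A]
    (D : Derivation S₀ A A) {f : A} (hfQ : f ∈ Q) (hDf : D f ∉ Q) :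
    algebraMap A S f ∉ (maximalIdeal S) ^ 2 := by
  rw [← IsLocalization.AtPrime.map_eq_maximalIdeal Q S, ← Ideal.map_pow,
    IsLocalization.algebraMap_mem_map_algebraMap_iff Q.primeCompl]
  rintro ⟨u, hu, huf⟩
  exact mul_notMem_sq_of_derivation_notMem D hfQ hDf hu huf

/-! ### B. The reduced hypersurface `V(G) ⊆ Spec A` at a point of order one -/

/-- The stalk of the principal ideal sheaf of a global section is generated by its germ. [OURS · folklore] -/
theorem stalkIdeal_ofIdealTop_span_singleton_eq {X : Scheme.{0}} (f : Γ(X, ⊤)) (x : X) :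
    stalkIdeal (ofIdealTop (Ideal.span {f})) x = Ideal.span {(X.presheaf.germ ⊤ x trivial).hom f} := by
  obtain ⟨U, hU, hxU, -⟩ :=
    exists_isAffineOpen_mem_and_subset (X := X) (x := x) (U := ⊤) (Opens.mem_top x)
  rw [stalkIdeal_eq_map_germ _ ⟨U, hU⟩ hxU, ofIdealTop_ideal, Ideal.map_map, Ideal.map_span,
    Set.image_singleton]
  congr 2
  rw [← CommRingCat.hom_comp, X.presheaf.germ_res (homOfLE le_top) x hxU]

/-- The vanishing ideal sheaf of the closed set `V(G) ⊆ Spec A` is the radical of the principal ideal sheaf `G·𝒪`. [OURS · folklore] -/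
theorem vanishingIdeal_zeroLocus_singleton_eq {A : Type} [CommRing A] (G : A) :
    vanishingIdeal (⟨PrimeSpectrum.zeroLocus {G}, PrimeSpectrum.isClosed_zeroLocus _⟩ : Closeds (Spec (.of A))) =
      (ofIdealTop (Ideal.span {(Scheme.ΓSpecIso (.of A)).inv G})).radical := by
  rw [← vanishingIdeal_support]
  congr 1
  apply TopologicalSpace.Closeds.ext
  change PrimeSpectrum.zeroLocus {G} = ((ofIdealTop (Ideal.span {(Scheme.ΓSpecIso (.of A)).inv G})).support : Set (Spec (.of A)))
  rw [coe_support_ofIdealTop, Scheme.zeroLocus_span, ← Set.image_singleton]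
  exact (Spec_zeroLocus_eq_zeroLocus (R := .of A) {G}).symm

/-- The stalk at `y` of the vanishing ideal sheaf of `V(G) ⊆ Spec A` is the radical of the germ of `G`. [OURS · folklore] -/
theorem stalkIdeal_vanishingIdeal_zeroLocus_singleton {A : Type} [CommRing A] (G : A) (y : Spec (.of A)) :
    stalkIdeal (vanishingIdeal (⟨PrimeSpectrum.zeroLocus {G}, PrimeSpectrum.isClosed_zeroLocus _⟩ : Closeds (Spec (.of A)))) y =
      (Ideal.span {((Spec (.of A)).presheaf.germ ⊤ y trivial).hom ((Scheme.ΓSpecIso (.of A)).inv G)}).radical := by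
  rw [vanishingIdeal_zeroLocus_singleton_eq, stalkIdeal_radical, stalkIdeal_ofIdealTop_span_singleton_eq]

/-- **Order one ⇒ the reduced hypersurface is regular at the point.**  `A` a regular ring, `G ∈ A`, `y ∈ V(G)`, and some derivation `D` of `A` with
`D G ∉ 𝔭_y`: then the local ring at `y` of the REDUCED closed subscheme `V(G)_red ⊆ Spec A` — i.e. `𝒪_{Spec A, y} ⧸ 𝓘(V(G))_y` — is a regular local ring
(`G ∉ 𝔭_y⁽²⁾`, so `𝒪_y/(G)` is regular, hence a domain, so `(G)_y` is prime and equals `√(G)_y = 𝓘(V(G))_y`). [OURS · folklore (Jacobian criterion, easy half)] -/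
theorem isRegularLocalRing_stalk_quotient_vanishingIdeal_zeroLocus {A : Type} [CommRing A] [IsRegularRing A]
    {S₀ : Type*} [CommSemiring S₀] [Algebra S₀ A] (D : Derivation S₀ A A) (G : A)
    (y : Spec (.of A)) (hGy : G ∈ y.asIdeal) (hDG : D G ∉ y.asIdeal) :
    IsRegularLocalRing ((Spec (.of A)).presheaf.stalk y ⧸
      stalkIdeal (vanishingIdeal (⟨PrimeSpectrum.zeroLocus {G}, PrimeSpectrum.isClosed_zeroLocus _⟩ : Closeds (Spec (.of A)))) y) := by
  letI : Algebra A ((Spec (.of A)).presheaf.stalk y) := StructureSheaf.stalkAlgebra (R := A) y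
  haveI : IsLocalization.AtPrime ((Spec (.of A)).presheaf.stalk y) y.asIdeal := StructureSheaf.IsLocalization.to_stalk A y
  haveI hreg : IsRegularLocalRing ((Spec (.of A)).presheaf.stalk y) := Scheme.isRegular_Spec (.of A) y
  have hfm : algebraMap A ((Spec (.of A)).presheaf.stalk y) G ∈ maximalIdeal _ := by
    rw [← IsLocalization.AtPrime.map_eq_maximalIdeal y.asIdeal]
    exact Ideal.mem_map_of_mem _ hGy
  have hfm2 : algebraMap A ((Spec (.of A)).presheaf.stalk y) G ∉ maximalIdeal _ ^ 2 :=
    algebraMap_notMem_sq_maximalIdeal_of_derivation y.asIdeal D hGy hDG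
  have hq := (IsRegularLocalRing.quotient_span_singleton hfm hfm2).1
  haveI : IsDomain ((Spec (.of A)).presheaf.stalk y ⧸ Ideal.span {algebraMap A ((Spec (.of A)).presheaf.stalk y) G}) :=
    @isDomain_of_isRegularLocalRing _ _ hq
  have hprime : (Ideal.span {algebraMap A ((Spec (.of A)).presheaf.stalk y) G}).IsPrime :=
    (Ideal.Quotient.isDomain_iff_prime _).mp inferInstance
  rw [stalkIdeal_vanishingIdeal_zeroLocus_singleton G y,
    show ((Spec (.of A)).presheaf.germ ⊤ y trivial).hom ((Scheme.ΓSpecIso (.of A)).inv G) =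
      algebraMap A ((Spec (.of A)).presheaf.stalk y) G from rfl]
  haveI := hq
  exact IsRegularLocalRing.of_ringEquiv (Ideal.quotEquivOfEq hprime.radical.symm)


/-! ### C. Toric charts: the fibre over the origin, a closed point on the fibre, a non-vanishing partial, the reduced closure at a chart point -/

section Charts

variable {n : ℕ} {k : Type} [Field k]

/-- **Over the origin ⇒ positive weight on the vanishing coordinates.**  If the chart point `y ∈ U_B = 𝔸ⁿ_k` maps to the origin under the toric chart map
`t_l ↦ ∏ᵢ yᵢ^{B i l}`, then every column `l` has some `i` with `B i l > 0` and `yᵢ ∈ 𝔭_y`. [OURS] -/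
theorem exists_pos_mem_of_comap_eq_affOrigin (B : Fin n → Fin n → ℕ) (ψ : MvPolynomial (Fin n) k →+* MvPolynomial (Fin n) k)
    (hψ : ∀ l, ψ (X l) = ∏ i, X i ^ B i l) (y : Aff n k)
    (hy : (Spec.map (CommRingCat.ofHom ψ)).base y = affOrigin n k) (l : Fin n) :
    ∃ i, 0 < B i l ∧ (X i : MvPolynomial (Fin n) k) ∈ y.asIdeal := by
  have h1 : ψ (X l) ∈ y.asIdeal := by
    have hX : (X l : MvPolynomial (Fin n) k) ∈ ((Spec.map (CommRingCat.ofHom ψ)).base y).asIdeal := by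
      rw [hy]
      exact (mem_originIdeal_iff k n).mpr (constantCoeff_X k l)
    exact hX
  rw [hψ, Ideal.IsPrime.prod_mem_iff] at h1
  obtain ⟨i, -, hi⟩ := h1
  refine ⟨i, Nat.pos_of_ne_zero fun h0 => ?_, y.2.mem_of_pow_mem _ hi⟩
  rw [h0, pow_zero] at hi
  exact y.2.ne_top ((Ideal.eq_top_iff_one _).mpr hi)

/-- Over an algebraically closed field every proper ideal of `k[y₁, …, yₙ]` has a common zero (weak Nullstellensatz). [OURS · Mathlib Nullstellensatz repackaged] -/
theorem exists_forall_eval_eq_zero [IsAlgClosed k] (p : Ideal (MvPolynomial (Fin n) k)) (hp : p ≠ ⊤) :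
    ∃ a : Fin n → k, ∀ f ∈ p, eval a f = 0 := by
  obtain ⟨m, hm, hpm⟩ := Ideal.exists_le_maximal p hp
  obtain ⟨a, rfl⟩ := (MvPolynomial.isMaximal_iff_eq_vanishingIdeal_singleton (I := m)).mp hm
  refine ⟨a, fun f hf => ?_⟩
  exact (MvPolynomial.mem_vanishingIdeal_singleton_iff a f).mp (hpm hf)

/-- **A non-vanishing partial at every fibre point of the strict transform (scheme points).**  At a WON position, in the smooth chart `B` of a cone `σ ∈ Φ`, for
`g` locally Newton-nondegenerate: every prime `𝔭 ∋ G := toricStrict B g` whose vanishing coordinates carry a positive weight in every column misses some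
partial `∂ⱼ G` — by `exists_eval_pderiv_toricStrict_ne_zero` at a CLOSED point `a` of `V(𝔭)` (`k = k̄`; the orbit of `a` is still over the origin).  [OURS] -/
theorem exists_pderiv_toricStrict_notMem [IsAlgClosed k] (B : Fin n → Fin n → ℕ) (hB : IsUnit (zMat B).det)
    {g : MvPolynomial (Fin n) k} (hND : IsLocallyNewtonNondegenerate g)
    {Φ : Finset (Finset (Ray n))} (hW : Won (table g) Φ) (hσ : Finset.univ.image (fun i => rayOf (B i)) ∈ Φ)
    (p : Ideal (MvPolynomial (Fin n) k)) [p.IsPrime] (hGp : toricStrict B g ∈ p)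
    (hw : ∀ l, ∃ i, 0 < B i l ∧ (X i : MvPolynomial (Fin n) k) ∈ p) :
    ∃ j, pderiv j (toricStrict B g) ∉ p := by
  classical
  obtain ⟨a, ha⟩ := exists_forall_eval_eq_zero p (Ideal.IsPrime.ne_top ‹_›)
  set I : Finset (Fin n) := Finset.univ.filter (fun i => a i = 0) with hIdef
  have hI : ¬ Bad (table g) (I.image fun i => rayOf (B i)) :=
    not_bad_face_of_won hW hσ (Finset.image_subset_image (Finset.subset_univ I))
  have hwI : ∀ l, ∃ i ∈ I, 0 < B i l := fun l => by
    obtain ⟨i, hil, hXi⟩ := hw l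
    refine ⟨i, Finset.mem_filter.mpr ⟨Finset.mem_univ _, ?_⟩, hil⟩
    have := ha _ hXi
    rwa [eval_X] at this
  obtain ⟨j, -, hj⟩ := exists_eval_pderiv_toricStrict_ne_zero B (det_cast_ne_zero_of_isUnit B hB) hND I hI hwI a
    (fun i hi => (Finset.mem_filter.mp hi).2) (fun j hj h0 => hj (Finset.mem_filter.mpr ⟨Finset.mem_univ _, h0⟩)) (ha _ hGp)
  exact ⟨j, fun h => hj (ha _ h)⟩

/-- **A scheme covered by affine-space charts is regular.** [OURS · folklore] -/
theorem isRegular_of_forall_exists_affChart {F : Scheme.{0}}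
    (h : ∀ x : F, ∃ c : Aff n k ⟶ F, IsOpenImmersion c ∧ x ∈ Set.range c.base) : Scheme.IsRegular F := by
  intro x
  obtain ⟨c, hc, y, rfl⟩ := h x
  haveI : IsRegularLocalRing ((Aff n k).presheaf.stalk y) := Scheme.isRegular_Spec _ y
  exact IsRegularLocalRing.of_ringEquiv (asIso (c.stalkMap y)).commRingCatIsoToRingEquiv.symm

/-- **The reduced closure of `T` is regular at a chart point of order one.**  `c : 𝔸ⁿ_k ⟶ F` an open immersion with `c⁻¹ T = V(G)`, `y ∈ V(G)` a point at which some
partial `∂ⱼ G` does not vanish; then the reduced structure on the closed set `Z = T` is regular at the point `z` over `c y` (transport of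
`isRegularLocalRing_stalk_quotient_vanishingIdeal_zeroLocus` along the stalk isomorphism of `c`). [OURS] -/
theorem isRegularLocalRing_stalk_vanishingIdeal_of_chart {F : Scheme.{0}} (T : Set F) (Z : Closeds F) (hZ : (Z : Set F) = T)
    (c : Aff n k ⟶ F) [IsOpenImmersion c] (G : MvPolynomial (Fin n) k) (hcT : c.base ⁻¹' T = PrimeSpectrum.zeroLocus {G})
    (y : Aff n k) (hGy : G ∈ y.asIdeal) (hD : ∃ j, pderiv j G ∉ y.asIdeal)
    (z : (vanishingIdeal Z).subscheme) (hz : (vanishingIdeal Z).subschemeι.base z = c.base y) :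
    IsRegularLocalRing ((vanishingIdeal Z).subscheme.presheaf.stalk z) := by
  rw [isRegularLocalRing_stalk_subscheme_iff, hz]
  obtain ⟨j, hj⟩ := hD
  have hcomap : (vanishingIdeal Z).comap c =
      vanishingIdeal (⟨PrimeSpectrum.zeroLocus {G}, PrimeSpectrum.isClosed_zeroLocus _⟩ : Closeds (Aff n k)) := by
    rw [comap_vanishingIdeal_of_isOpenImmersion]
    congr 1
    apply TopologicalSpace.Closeds.ext
    rw [Closeds.coe_preimage, hZ]
    exact hcT
  have hreg := isRegularLocalRing_stalk_quotient_vanishingIdeal_zeroLocus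
    (pderiv j : Derivation k (MvPolynomial (Fin n) k) (MvPolynomial (Fin n) k)) G y hGy hj
  rw [← hcomap, stalkIdeal_comap_eq_map_stalkMap] at hreg
  haveI := hreg
  let e : F.presheaf.stalk (c.base y) ≃+* (Aff n k).presheaf.stalk y := (asIso (c.stalkMap y)).commRingCatIsoToRingEquiv
  exact IsRegularLocalRing.of_ringEquiv
    (Ideal.quotientEquiv (stalkIdeal (vanishingIdeal Z) (c.base y))
      ((stalkIdeal (vanishingIdeal Z) (c.base y)).map (c.stalkMap y).hom) e rfl).symm

/-! ### D. (B4α2) END of the model round from the chart data of a toric stage (the `ToricStage`-free core of `modelEnd`) -/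

/-- **(B4α2) core — `ModelEnd` from the toric charts.**  At a WON position `Φ` for a convenient, locally Newton-nondegenerate `g` over `k = k̄`: if every point of
`F` lies in an affine-space chart `c : 𝔸ⁿ_k ⟶ F` (open immersion) attached to a smooth cone of `Φ` with ray matrix `B`, compatible with `φ` through the toric
chart map `t_l ↦ ∏ᵢ yᵢ^{B i l}` and carrying `T` to `V(toricStrict B g)`, then `F` is regular and the REDUCED closure of `T` is regular at every point over the
origin.  (Regularity of `𝔸ⁿ_k` + stalk isomorphisms of open immersions; END: the chart point `y` over the origin has vanishing coordinates of positive weight in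
every column, a closed point `a ∈ V(𝔭_y)` exists (`k = k̄`) and is still over the origin, `exists_eval_pderiv_toricStrict_ne_zero` gives `∂ⱼG(a) ≠ 0`, so
`∂ⱼG ∉ 𝔭_y`, `G ∉ 𝔭_y⁽²⁾`, `𝒪_y/(G)` regular, `(G)_y = √(G)_y = 𝓘(T̂)_y`.)  MUST use `k = k̄` (crit-3's witness 2026-08-28: over `ℚ` the non-rational fibre
point `1 + 2y² = 0` of `(X₀²+2X₁²)² + X₀⁶ + X₁⁶` is singular although the germ is locally ND over `ℚ`).  [OURS · L1 W4.5b · iso-w1] -/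
theorem modelEnd_of_charts [IsAlgClosed k] (g : MvPolynomial (Fin n) k) (hg : LocalND g)
    (Φ : Finset (Finset (Ray n))) (F : Scheme.{0}) (φ : F ⟶ Aff n k) (T : Set F)
    (hcharts : ∀ x : F, ∃ σ ∈ Φ, ∃ (B : Fin n → Fin n → ℕ) (c : Aff n k ⟶ F), IsOpenImmersion c ∧ x ∈ Set.range c.base ∧
      σ = Finset.univ.image (fun i => rayOf (B i)) ∧ IsUnit (zMat B).det ∧
      (∃ ψ : MvPolynomial (Fin n) k →+* MvPolynomial (Fin n) k, (∀ l, ψ (X l) = ∏ i, X i ^ B i l) ∧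
        c ≫ φ = Spec.map (CommRingCat.ofHom ψ)) ∧
      c.base ⁻¹' T = PrimeSpectrum.zeroLocus {toricStrict B g})
    (hT : IsClosed T) (hW : Won (table g) Φ) :
    Scheme.IsRegular F ∧
    (∀ z : ↥(vanishingIdeal (⟨closure T, isClosed_closure⟩ : Closeds F)).subscheme,
      ((vanishingIdeal (⟨closure T, isClosed_closure⟩ : Closeds F)).subschemeι z : F) ∈ φ ⁻¹' {affOrigin n k} →
      IsRegularLocalRing ((vanishingIdeal (⟨closure T, isClosed_closure⟩ : Closeds F)).subscheme.presheaf.stalk z)) := by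
  refine ⟨isRegular_of_forall_exists_affChart (n := n) (k := k) fun x => ?_, ?_⟩
  · obtain ⟨-, -, -, c, hc, hx, -⟩ := hcharts x
    exact ⟨c, hc, hx⟩
  · -- generalise the closed set `closure T` to any `Z` with carrier `T`
    suffices h : ∀ (Z : Closeds F), (Z : Set F) = T → ∀ z : ↥(vanishingIdeal Z).subscheme,
        ((vanishingIdeal Z).subschemeι z : F) ∈ φ ⁻¹' {affOrigin n k} →
        IsRegularLocalRing ((vanishingIdeal Z).subscheme.presheaf.stalk z) from
      h _ hT.closure_eq
    intro Z hZT z hz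
    have hxT : ((vanishingIdeal Z).subschemeι z : F) ∈ T := by
      have hmem := Set.mem_range_self (f := fun t => ((vanishingIdeal Z).subschemeι t : F)) z
      rw [Scheme.IdealSheafData.range_subschemeι, coe_support_vanishingIdeal, hZT] at hmem
      exact hmem
    obtain ⟨σ, hσ, B, c, hc, ⟨y, hy⟩, hσB, hdet, ⟨ψ, hψ, hcφ⟩, hcT⟩ := hcharts ((vanishingIdeal Z).subschemeι z)
    have hGy : toricStrict B g ∈ y.asIdeal := by
      have hyT : y ∈ c.base ⁻¹' T := by rw [Set.mem_preimage, hy]; exact hxT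
      rw [hcT] at hyT
      exact hyT (Set.mem_singleton _)
    have hfib : (Spec.map (CommRingCat.ofHom ψ)).base y = affOrigin n k := by
      rw [← hcφ, Scheme.Hom.comp_apply, hy]
      exact hz
    have hw := exists_pos_mem_of_comap_eq_affOrigin B ψ hψ y hfib
    subst hσB
    have hD := exists_pderiv_toricStrict_notMem B hdet hg.2 hW hσ y.asIdeal hGy hw
    exact isRegularLocalRing_stalk_vanishingIdeal_of_chart T Z hZT c (toricStrict B g) hcT y hGy hD z hy.symm

end Charts

end Summit.ResolutionOfSingularities.ResolutionOfSingularities.Cruxes.EquisingularLiftNat.Sections.ND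

end
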